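import Summits.QuantumFields.YangMills.Theorems.BalabanUVNodesN12FarDatumSurgery
import Literature.MathematicalPhysics.QuantumFieldTheory.Balaban1983to89.Node00.MultiScaleFibreChartB
import Literature.MathematicalPhysics.QuantumFieldTheory.Balaban1983to89.B15Prop1GradientFromNearValueB
import HarnessLib

/-!
# DAG node N12 [B15] — FAR-DATUM SURGERY: the (2.12) minimisers at `𝐁_k(Z)` do not read the `k`-datum off `Z^{(k)}` — **BOND-DATUM EDITION** (`…N12FarDatumSurgeryB`, USED DECLARATIONS ONLY)

The print-datum ([Balaban1984PropagatorsII] (2.3)) (γ) twin of `Summits/…/Theorems/BalabanUVNodesN12FarDatumSurgery.lean`: the declarations of the parent whose STATEMENT reads the determining datum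
(`agreeOn_surgery`, `exists_isMinimizer_surgery_far`, `isMinimizer_surgery_far`) and which N12's junction of record v14ᴸ uses (dag-n12-c g35 probe-2 census `UsedConstsN12RoadTyped2`, THEOREMS block), re-typed over a
BOND-LEVEL datum `𝔅 : BDetSet` (F0a `B15DeterminingSetsB`) and dag-n12-c's bond-datum chart `Node00.msChartB` (✓p774329; `msChart 𝐁 = msChartB (bondsDet 𝐁)` by `rfl`).  GENERATOR twin
(this seat's `work/g32/gen_thm.py`, block-extracted from the parent's tree bytes): namespace `…N12FarDatumSurgeryB`, SAME short names, `DetSet ↦ BDetSet`, `AgreeOn 𝐁 ↦ AgreeOnB 𝔅`,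
`IsMinimizer ↦ IsMinimizerB`, `bondsOf (𝐁 j) ↦ 𝔅 j`, `msChart ∕ constrCard ∕ constrEnum ∕ ConstrSet ↦ …B`, NODE 00 chart lemmas `…msChart… ↦ …msChartB…`; proofs VERBATIM; the parent's
datum-free declarations REUSED BY NAME (`open`), never copied (private plumbing excepted, №366 R2).  The parent's (b) statements are the instances `𝔅 := bondsDet 𝐁`.
STRUCTURAL RE-KEY AT LEVEL 0 (director-ym №339 ruling (α); dag-n12-c RE-KEY NOTE): the far surgery pins a plaquette with a corner off `Z` through print`s `Λ₀`-membership of its four bonds — BOTH end-points off `Ω₁(Z)` (hand lemma `mem_lamBondsSeq_zero_of_corner_not_mem`, collar `2M₁+3 ≤ L·M₁−1`, + dag-n12-c`s `mem_lamDatumP_maxDomT_zero_of_not_mem₂`) — instead of the parent`s one-end-point (b)-membership; everything else verbatim over `lamBondsSeq (maxDomT ν.M₁ Z) k`.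
Cell `pub-ymgap` (HUMAN RULINGS D-0062 ∕ D-0149), seat `pub-ymgap-dag-n12-d` g32 (R134 N12 [B15] s2; the (ii) Theorems-side re-key of N12's road at print's [II] (2.3) datum — director-ym №338 ∕
№343 (E1)(iii-b), FLAG №16 ∕ ruling (α); dag-n12-c DESIGN memo a793b2ebc0b803bf (ii); `N12-ROAD-TWIN-ORDER-2026-08-30.md`).  Count-neutral helper of K1⁹ `stmt-QuantumFields-27364`,
`--kind proof --supports … --as helper`.  THEOREMS ONLY (0 `def`, 0 `instance`, 0 `sorry`).

HONEST FRAMING (director-ym №338 (5)).  PURELY ADDITIVE: the parent stays landed and true on its own text; nothing in it is edited; no displayed premise of any consumer is deleted or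
weakened; every hypothesis of the parent stays a hypothesis.  Nothing of Bałaban's analysis asserted; N12 NOT discharged; K0⁷ ∕ K1⁹ NOT closed; counts unmoved (typed 28∕28 · discharged
8∕27, A 8∕28; K 1∕4); one finite 𝕋⁴ programme at fixed ε — R4 closes the conditional rung `BalabanLadder.UV` only; NOT the Yang–Mills mass gap (Clay); nothing continuum ∕ ℝ⁴ ∕ OS.

PARENT's DOCSTRING (the mathematics and the citations; read the site-level `𝐁` as the bond datum `𝔅`):
# DAG node N12 [B15] — FAR-DATUM SURGERY: the (2.12) minimisers at `𝐁_k(Z)` do not read the `k`-datum off `Z^{(k)}`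

Cell `pub-ymgap` (HUMAN RULINGS D-0062 ∕ D-0149), width seat `pub-ymgap-dag-n12-w6` g18.  Key K1⁹ `stmt-QuantumFields-27364`, `--kind proof --supports … --as helper`;
count-neutral; THEOREMS ONLY (0 `def`, 0 `instance`, 0 `sorry`).

WHY (cell bus 2026-08-29, ⚑ LOCATED-DATUM-FAR).  The (σ)_N letter of record `N12GaugeLetterLocExplicit.exists_gaugeLetterLoc_atRecord_explicit` asks its region datum `W` to be
`ρn`-flat on a bond set `𝒞` containing the `k`-shadow of EVERY face-crossing member of `𝐁_k(Z)` — at level `0` these are all fine bonds meeting `Ω₁(Z)ᶜ ⊇ Zᶜ` ([III] (2.2)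
`Γ₀ = Ω₁ᶜ`), so `𝒞` reaches arbitrarily far off `Z`, where the knit's datum `ext V_k = V_k` is a bare large-field variable.  THIS FILE proves that the variational problem does
not care: if two `k`-data `W, W′` agree on the `k`-bonds INSIDE `Z^{(k)}`, the SURGERED configuration (`U₀` on the fine bonds with both ends in `Z`, the pulled-back datum
`Q_k^{s*}W′` elsewhere) is a (2.12) minimiser for `M˙(Q_k^{s*}W′)` whenever `U₀` is one for `M˙(Q_k^{s*}W)` — so the (σ)_N producer may be run at the LOCALISED datum
(`W′ := W` on `Z^{(k)}`, `1` off it; next file `…N12GaugeLetterLocExplicitOnZ`).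

[Balaban1988Convergent] = «[III]», (2.2) p. 255 (`Γ₀ = Ω₁ᶜ`), (2.10)–(2.13) pp. 256–257, (1.3) p. 246; [Balaban1985Variational] = «[15]», (2)–(4) p. 278; [Balaban1985RegularSpaces] (1.7),
(1.9) p. 77; [Balaban1987RG1] (0.2) p. 252, (0.4) p. 253.

CONTENTS (namespace `Summit.QuantumFields.YangMills.BalabanUVNodes.N12FarDatumSurgery`).
* (§1 collar bookkeeping and §2 the class locality `mem_regMSCoPOfRecord_of_eqOn_inside` are the preliminaries file `…N12FarDatumSurgeryPrelim`, consumed by name.)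
* §3 the (2.10) data: the surgered configuration carries the data of `Q_k^{s*}W′` (`agreeOn_surgery`), by `Bj_zero` at level `0` and two-block locality above.
* §4 ★★★ `isMinimizer_surgery_far` + `exists_surgery`.

HONEST FRAMING.  Lattice bookkeeping + one plaquette-wise action identity; nothing of Bałaban's estimates asserted or refuted; count-neutral helper; N12 NOT discharged; K1⁹ NOT
closed; counts unmoved; one finite 𝕋⁴ programme at fixed ε — R4 closes the conditional rung `BalabanLadder.UV` only; NOT continuum ∕ OS ∕ mass gap ∕ Clay.
-/

noncomputable section

open scoped BigOperators

namespace Summit.QuantumFields.YangMills.BalabanUVNodes.N12FarDatumSurgeryB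

open Literature.MathematicalPhysics.QuantumFieldTheory.Balaban1983to89.B15DeterminingSetsB

open Set
open Literature.MathematicalPhysics.QuantumFieldTheory.Balaban1983to89
open T4Continuum GaugeField B15DeterminingSets BlockAveraging
open B14.Eq213MaximalDomains (side)
open B14.Eq213DetSet (Bj Bj_zero Bj_mid Bj_top maxDomT maxDomT_zero maxDomT_subset maxDomT_antitone dist_maxDomT isBlockUnion_maxDomT)
open B14.Eq22Determines (blockIter IsBlockUnion)
open B14DomainGeom (Pt Within)
open B15Eq112TorusCover (cover lift cover_lift cover_apply)
open B15Claim189CubePin (cover_add_single)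
open B10StarCount (shift_unshift unshift_shift)
open B14SeparationOfRecord (mem_hullD_iff)
open B5Eq118OneStroke (iterBlockOf)
open B8Eq17ClassAkV1 (plaqsOf mem_plaqsOf)
open Literature.MathematicalPhysics.QuantumFieldTheory.BalabanImbrieJaffe1984to88.BIJ85Eq453GaugeField (qsstarGIter0)
open B14.Eq216Concrete (qsstarGIter0_eq)
open Summit.QuantumFields.YangMills.BalabanUVNodes.N12DirectSurjSharpDelta2 (avgFamily_congr_sharp)
open Summit.QuantumFields.YangMills.BalabanUVNodes.N12FlatLinAvgOntoPins (mem_maxDomT_of_adjacent)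
open Summit.QuantumFields.YangMills.BalabanUVNodes.N12BjCollarRoots (mem_maxDomT_of_iterBlockOf_mem_Bj)
open Summit.QuantumFields.YangMills.BalabanUVNodes.N12FarDatumSurgery (exists_surgery mem_bondsOf_zero_of_corner_not_mem mem_of_iterBlockOf_eq_member qsstarGIter0_congr_inside wilsonAction4_sub_eq)

section PrintLevelZero

open Summit.QuantumFields.YangMills.BalabanUVNodes.N12FarDatumSurgeryPrelim

variable {F : T4Family} {N : ℕ} [NeZero N] {Kt k : ℕ} {ν : Node00.Stage7Numerics} {Z : Set (Site (F.P Kt) 0)}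

/-- **PRINT's LEVEL-0 MEMBERSHIP FOR THE BONDS OF A PLAQUETTE WITH A CORNER OFF `Z`** — the print-datum ([Balaban1984PropagatorsII] (2.3): `Λ₀ = Ω₁ᶜ`, BOTH end-points) edition of the
parent's `mem_bondsOf_zero_of_corner_not_mem` (reading (b): ONE end-point): were EITHER end-point of a bond `b` of `∂p` in `Ω₁(Z)`, all four corners of `p` — within four unit steps of
that end-point — would lie in `Z` (the collar `2M₁ + 3 ≤ L·M₁ − 1`, parent's `margin_le`); so both end-points are off `Ω₁(Z)`, and dag-n12-c's both-end-points clause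
`B15Prop1GradientFromNearValueB.mem_lamDatumP_maxDomT_zero_of_not_mem₂` (`Ω₁(Z)` a union of `1`-blocks) puts `b` in `Λ₀`.  This is the LOCATED structural content of the (ii) re-key at
level `0` (director-ym №339 ruling (α); dag-n12-c RE-KEY NOTE). [cite: Balaban1984PropagatorsII, (2.3) p.224; Balaban1988Convergent, (2.2) p.255, (2.13) pp.256–257] -/
theorem mem_lamBondsSeq_zero_of_corner_not_mem (hM4 : 4 ≤ ν.M₁) (hk1 : 1 ≤ k) (hk : k ≤ (F.P Kt).m + (F.P Kt).K)
    (hdiv : side (F.P Kt).L ν.M₁ k ∣ (F.P Kt).sitesPerDir 0)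
    {p : Plaq (F.P Kt) 0} (hc : ¬ (p.src ∈ Z ∧ p.src.shift p.μ ∈ Z ∧ p.src.shift p.ν ∈ Z ∧ (p.src.shift p.μ).shift p.ν ∈ Z))
    {b : PBond (F.P Kt) 0} (hb : b ∈ B14.Eq12InteriorLocality.plaqBonds p) : b ∈ lamBondsSeq (maxDomT ν.M₁ Z) k 0 := by
  have hM : 1 ≤ ν.M₁ := le_trans (by norm_num) hM4
  have hm := margin_le (F := F) (Kt := Kt) hM4
  -- a cover witness of radius ≤ 2 at `p.src` puts all four corners of `p` in `Z`
  have key : ∀ {r : ℤ}, r ≤ 2 →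
      (∃ z₁ z : Pt (F.P Kt).d, cover (F.P Kt) z₁ ∈ maxDomT ν.M₁ Z 1 ∧ cover (F.P Kt) z = p.src ∧ Within r z₁ z) → False := by
    intro r hr hp
    exact hc ⟨mem_of_near hM hk1 hdiv (by linarith) hp, mem_of_near hM hk1 hdiv (by linarith) (near_shift hp p.μ),
      mem_of_near hM hk1 hdiv (by linarith) (near_shift hp p.ν), mem_of_near hM hk1 hdiv (by linarith) (near_shift (near_shift hp p.μ) p.ν)⟩
  have hs : b.src ∉ maxDomT ν.M₁ Z 1 := fun hsrc => by
    have h0 := near_of_mem_maxDomT (Z := Z) hM le_rfl hsrc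
    rcases (B14.Eq12InteriorLocality.mem_plaqBonds).1 hb with rfl | rfl | rfl | rfl
    · exact key (r := 0) (by norm_num) h0
    · have := near_unshift h0 p.μ
      rw [show (p.src.shift p.μ).unshift p.μ = p.src from unshift_shift _ _] at this
      exact key (r := 0 + 1) (by norm_num) this
    · have := near_unshift h0 p.ν
      rw [show (p.src.shift p.ν).unshift p.ν = p.src from unshift_shift _ _] at this
      exact key (r := 0 + 1) (by norm_num) this
    · exact key (r := 0) (by norm_num) h0
  have ht : b.tgt ∉ maxDomT ν.M₁ Z 1 := fun htgt => by
    have h0 := near_of_mem_maxDomT (Z := Z) hM le_rfl htgt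
    rcases (B14.Eq12InteriorLocality.mem_plaqBonds).1 hb with rfl | rfl | rfl | rfl
    · have := near_unshift h0 p.μ
      rw [show (PBond.tgt (⟨p.src, p.μ⟩ : PBond (F.P Kt) 0)).unshift p.μ = p.src from unshift_shift _ _] at this
      exact key (r := 0 + 1) (by norm_num) this
    · have := near_unshift (near_unshift h0 p.ν) p.μ
      rw [show ((PBond.tgt (⟨p.src.shift p.μ, p.ν⟩ : PBond (F.P Kt) 0)).unshift p.ν).unshift p.μ = p.src by
        show (((p.src.shift p.μ).shift p.ν).unshift p.ν).unshift p.μ = p.src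
        rw [unshift_shift, unshift_shift]] at this
      exact key (r := 0 + 1 + 1) (by norm_num) this
    · have := near_unshift (near_unshift h0 p.μ) p.ν
      rw [show ((PBond.tgt (⟨p.src.shift p.ν, p.μ⟩ : PBond (F.P Kt) 0)).unshift p.μ).unshift p.ν = p.src by
        show (((p.src.shift p.ν).shift p.μ).unshift p.μ).unshift p.ν = p.src
        rw [unshift_shift, unshift_shift]] at this
      exact key (r := 0 + 1 + 1) (by norm_num) this
    · have := near_unshift h0 p.ν
      rw [show (PBond.tgt (⟨p.src, p.ν⟩ : PBond (F.P Kt) 0)).unshift p.ν = p.src from unshift_shift _ _] at this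
      exact key (r := 0 + 1) (by norm_num) this
  exact B15Prop1GradientFromNearValue.mem_lamDatumP_maxDomT_zero_of_not_mem₂ hM hk1 hk hdiv b hs ht

end PrintLevelZero

section
variable {P : Params}
open Summit.QuantumFields.YangMills.BalabanUVNodes.N12FarDatumSurgeryPrelim
variable {F : T4Family} {N : ℕ} [NeZero N] {Kt k : ℕ} {ν : Node00.Stage7Numerics} {Z : Set (Site (F.P Kt) 0)}

/-- **THE (2.10) DATA OF A SURGERED CONFIGURATION.**  If `U₀` carries the data of `Q_k^{s*}W` on `𝐁_k(Z)` and `U′ = U₀` on the fine bonds with both ends in `Z`, `U′ = Q_k^{s*}W′` elsewhere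
(`W′ = W` inside `Z^{(k)}`), then `U′` carries the data of `Q_k^{s*}W′`: at level `0` the members are the bonds meeting `Ω₁ᶜ` (`Bj_zero`), pinned to the datum; above, a member's
average reads only its two blocks, inside `Z` (`avgFamily_congr_sharp`). [cite: Balaban1988Convergent, (2.2) p.255, (2.10)–(2.11) p.256, (2.13) pp.256–257] -/
theorem agreeOn_surgery (hM2 : 2 ≤ ν.M₁) (hk : k ≤ (F.P Kt).m + (F.P Kt).K) (hdiv : side (F.P Kt).L ν.M₁ k ∣ (F.P Kt).sitesPerDir 0) (hZblk : IsBlockUnion k Z)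
    {W W' : GaugeField (F.P Kt) k (Node00.SU N)} (hWW' : ∀ e : PBond (F.P Kt) k, e.src ∈ pts k Z → e.tgt ∈ pts k Z → W' e = W e)
    {U₀ U' : GaugeField (F.P Kt) 0 (Node00.SU N)} (hdata : AgreeOnB (lamBondsSeq (maxDomT ν.M₁ Z) k) (avgFamily (Node00.avOfRecord F N Kt) U₀) (avgFamily (Node00.avOfRecord F N Kt) (qsstarGIter0 k W)))
    (hin : ∀ b : PBond (F.P Kt) 0, b.src ∈ Z → b.tgt ∈ Z → U' b = U₀ b)
    (hout : ∀ b : PBond (F.P Kt) 0, ¬ (b.src ∈ Z ∧ b.tgt ∈ Z) → U' b = qsstarGIter0 k W' b) :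
    AgreeOnB (lamBondsSeq (maxDomT ν.M₁ Z) k) (avgFamily (Node00.avOfRecord F N Kt) U') (avgFamily (Node00.avOfRecord F N Kt) (qsstarGIter0 k W')) := by
  intro j c hc
  rcases Nat.eq_zero_or_pos j with rfl | hj
  · -- level 0: the bond itself
    show U' c = qsstarGIter0 k W' c
    by_cases hcin : c.src ∈ Z ∧ c.tgt ∈ Z
    · have h0 : U₀ c = qsstarGIter0 k W c := hdata 0 c hc
      rw [hin c hcin.1 hcin.2, h0, qsstarGIter0_congr_inside hk hZblk hWW' hcin.1 hcin.2]
    · exact hout c hcin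
  · have hjk : j ≤ k := by
      by_contra h
      rw [lamBondsSeq_of_gt _ _ (not_le.mp h)] at hc
      simp at hc
    have hjK : j ≤ (F.P Kt).m + (F.P Kt).K := hjk.trans hk
    have h1 : avgFamily (Node00.avOfRecord F N Kt) U' j c = avgFamily (Node00.avOfRecord F N Kt) U₀ j c :=
      avgFamily_congr_sharp hjK c fun b₀ hs ht =>
        hin b₀ (mem_of_iterBlockOf_eq_member hM2 hk hdiv hj hjk (lamBondsSeq_subset_bondsOf_genSet _ _ _ hc) hs) (mem_of_iterBlockOf_eq_member hM2 hk hdiv hj hjk (lamBondsSeq_subset_bondsOf_genSet _ _ _ hc) ht)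
    have h2 : avgFamily (Node00.avOfRecord F N Kt) (qsstarGIter0 k W) j c = avgFamily (Node00.avOfRecord F N Kt) (qsstarGIter0 k W') j c :=
      avgFamily_congr_sharp hjK c fun b₀ hs ht =>
        (qsstarGIter0_congr_inside hk hZblk hWW' (mem_of_iterBlockOf_eq_member hM2 hk hdiv hj hjk (lamBondsSeq_subset_bondsOf_genSet _ _ _ hc) hs)
          (mem_of_iterBlockOf_eq_member hM2 hk hdiv hj hjk (lamBondsSeq_subset_bondsOf_genSet _ _ _ hc) ht)).symm
    rw [h1, hdata j c hc, h2]

end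

section
variable {P : Params}
open Summit.QuantumFields.YangMills.BalabanUVNodes.N12FarDatumSurgeryPrelim
variable {F : T4Family} {N : ℕ} [NeZero N] {Kt k : ℕ} {ν : Node00.Stage7Numerics} {Z : Set (Site (F.P Kt) 0)}

/-- ★★★ **FAR-DATUM SURGERY OF (2.12) MINIMISERS.**  At the record's objects — NODE 00's class `U_k({Ω_j(Z)}, εr)` (`regMSCoPOfRecord … (maxDomT ν.M₁ Z)`), the (2.13) determining set
`𝐁_k(Z)`, the averaging of record, `Z` a union of `k`-blocks, `L^k·M₁ ∣ 2L^{m+K}`, `M₁ ≥ 4`, `1 ≤ k ≤ m + K`: if the `k`-data `W, W′` agree on the `k`-bonds inside `Z^{(k)}` and `U₀`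
is a minimiser for the data `M˙(Q_k^{s*}W)`, then every configuration `U′` with `U′ = U₀` on the fine bonds with both ends in `Z` and `U′ = Q_k^{s*}W′` elsewhere is a minimiser for
the data `M˙(Q_k^{s*}W′)`.  (Class: §2; data: §3; minimality: a competitor `V` for `W′` is surgered back to a competitor `V♮` for `W`, and `A(U′) − A(V) = A(U₀) − A(V♮)` plaquette by
plaquette — all corners in `Z`: the free variables agree pairwise; a corner off `Z`: every bond is a level-0 member, pinned on both sides.)
[cite: Balaban1988Convergent, (2.2) p.255, (2.10)–(2.13) pp.256–257, (1.3) p.246; Balaban1985Variational, (2)–(4) p.278; Balaban1987RG1, (0.2) p.252] -/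
theorem isMinimizer_surgery_far (hM4 : 4 ≤ ν.M₁) (hk1 : 1 ≤ k) (hk : k ≤ (F.P Kt).m + (F.P Kt).K) (hdiv : side (F.P Kt).L ν.M₁ k ∣ (F.P Kt).sitesPerDir 0)
    (hZblk : IsBlockUnion k Z)
    {W W' : GaugeField (F.P Kt) k (Node00.SU N)} (hWW' : ∀ e : PBond (F.P Kt) k, e.src ∈ pts k Z → e.tgt ∈ pts k Z → W' e = W e)
    {U₀ : GaugeField (F.P Kt) 0 (Node00.SU N)}
    (hmin : IsMinimizerB (Node00.avOfRecord F N Kt) (Node00.regMSCoPOfRecord F N ν Kt k (maxDomT ν.M₁ Z)) (lamBondsSeq (maxDomT ν.M₁ Z) k)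
      (avgFamily (Node00.avOfRecord F N Kt) (qsstarGIter0 k W)) U₀)
    {U' : GaugeField (F.P Kt) 0 (Node00.SU N)} (hin : ∀ b : PBond (F.P Kt) 0, b.src ∈ Z → b.tgt ∈ Z → U' b = U₀ b)
    (hout : ∀ b : PBond (F.P Kt) 0, ¬ (b.src ∈ Z ∧ b.tgt ∈ Z) → U' b = qsstarGIter0 k W' b) :
    IsMinimizerB (Node00.avOfRecord F N Kt) (Node00.regMSCoPOfRecord F N ν Kt k (maxDomT ν.M₁ Z)) (lamBondsSeq (maxDomT ν.M₁ Z) k)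
      (avgFamily (Node00.avOfRecord F N Kt) (qsstarGIter0 k W')) U' := by
  have hM2 : 2 ≤ ν.M₁ := le_trans (by norm_num) hM4
  have hWW'symm : ∀ e : PBond (F.P Kt) k, e.src ∈ pts k Z → e.tgt ∈ pts k Z → W e = W' e := fun e hs ht => (hWW' e hs ht).symm
  refine ⟨mem_regMSCoPOfRecord_of_eqOn_inside hM4 hk1 hdiv hin hmin.1, agreeOn_surgery hM2 hk hdiv hZblk hWW' hmin.2.1 hin hout, fun V hV hVdata => ?_⟩
  -- surger the competitor back to the datum `W`
  obtain ⟨V', hV'in, hV'out⟩ := exists_surgery (Z := Z) V (qsstarGIter0 k W)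
  have hV'reg : V' ∈ Node00.regMSCoPOfRecord F N ν Kt k (maxDomT ν.M₁ Z) := mem_regMSCoPOfRecord_of_eqOn_inside hM4 hk1 hdiv hV'in hV
  have hV'data : AgreeOnB (lamBondsSeq (maxDomT ν.M₁ Z) k) (avgFamily (Node00.avOfRecord F N Kt) V') (avgFamily (Node00.avOfRecord F N Kt) (qsstarGIter0 k W)) :=
    agreeOn_surgery hM2 hk hdiv hZblk hWW'symm hVdata hV'in hV'out
  have hle := hmin.2.2 V' hV'reg hV'data
  -- the action identity, plaquette by plaquette
  have hid : wilsonAction4 U' - wilsonAction4 V = wilsonAction4 U₀ - wilsonAction4 V' := by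
    refine wilsonAction4_sub_eq fun p => ?_
    by_cases hc : p.src ∈ Z ∧ p.src.shift p.μ ∈ Z ∧ p.src.shift p.ν ∈ Z ∧ (p.src.shift p.μ).shift p.ν ∈ Z
    · exact Or.inl ⟨plaqHol_congr_of_corners (X := Z) hin p hc.1 hc.2.1 hc.2.2.1 hc.2.2.2,
        plaqHol_congr_of_corners (X := Z) (fun b hs ht => (hV'in b hs ht).symm) p hc.1 hc.2.1 hc.2.2.1 hc.2.2.2⟩
    · -- every bond of `p` is a level-0 member: pinned to `Q_k^{s*}W` under `U₀`, to `Q_k^{s*}W′` under `V`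
      have hpin : ∀ b ∈ B14.Eq12InteriorLocality.plaqBonds p, U' b = V b ∧ U₀ b = V' b := fun b hb => by
        have hb0 := mem_lamBondsSeq_zero_of_corner_not_mem (Z := Z) hM4 hk1 hk hdiv hc hb
        have hU₀ : U₀ b = qsstarGIter0 k W b := hmin.2.1 0 b hb0
        have hVb : V b = qsstarGIter0 k W' b := hVdata 0 b hb0
        by_cases hbin : b.src ∈ Z ∧ b.tgt ∈ Z
        · rw [hin b hbin.1 hbin.2, hV'in b hbin.1 hbin.2, hU₀, hVb, qsstarGIter0_congr_inside hk hZblk hWW' hbin.1 hbin.2]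
          exact ⟨rfl, rfl⟩
        · rw [hout b hbin, hV'out b hbin, hU₀, hVb]
          exact ⟨rfl, rfl⟩
      exact Or.inr ⟨B14.Eq12InteriorLocality.plaqHol_congr fun b hb => (hpin b hb).1, B14.Eq12InteriorLocality.plaqHol_congr fun b hb => (hpin b hb).2⟩
  linarith

end

section
variable {P : Params}
open Summit.QuantumFields.YangMills.BalabanUVNodes.N12FarDatumSurgeryPrelim
variable {F : T4Family} {N : ℕ} [NeZero N] {Kt k : ℕ} {ν : Node00.Stage7Numerics} {Z : Set (Site (F.P Kt) 0)}

/-- ★★ **COROLLARY — A MINIMISER FOR THE LOCALISED DATUM EXISTS WHENEVER ONE EXISTS FOR THE DATUM**, and it agrees with the given one on the bonds inside `Z`.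
[cite: Balaban1988Convergent, (2.12)–(2.13) pp.256–257; Balaban1985Variational, (2)–(4) p.278] -/
theorem exists_isMinimizer_surgery_far (hM4 : 4 ≤ ν.M₁) (hk1 : 1 ≤ k) (hk : k ≤ (F.P Kt).m + (F.P Kt).K) (hdiv : side (F.P Kt).L ν.M₁ k ∣ (F.P Kt).sitesPerDir 0)
    (hZblk : IsBlockUnion k Z)
    {W W' : GaugeField (F.P Kt) k (Node00.SU N)} (hWW' : ∀ e : PBond (F.P Kt) k, e.src ∈ pts k Z → e.tgt ∈ pts k Z → W' e = W e)
    {U₀ : GaugeField (F.P Kt) 0 (Node00.SU N)}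
    (hmin : IsMinimizerB (Node00.avOfRecord F N Kt) (Node00.regMSCoPOfRecord F N ν Kt k (maxDomT ν.M₁ Z)) (lamBondsSeq (maxDomT ν.M₁ Z) k)
      (avgFamily (Node00.avOfRecord F N Kt) (qsstarGIter0 k W)) U₀) :
    ∃ U' : GaugeField (F.P Kt) 0 (Node00.SU N), (∀ b : PBond (F.P Kt) 0, b.src ∈ Z → b.tgt ∈ Z → U' b = U₀ b) ∧
      IsMinimizerB (Node00.avOfRecord F N Kt) (Node00.regMSCoPOfRecord F N ν Kt k (maxDomT ν.M₁ Z)) (lamBondsSeq (maxDomT ν.M₁ Z) k)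
        (avgFamily (Node00.avOfRecord F N Kt) (qsstarGIter0 k W')) U' := by
  obtain ⟨U', hin, hout⟩ := exists_surgery (Z := Z) U₀ (qsstarGIter0 k W')
  exact ⟨U', hin, isMinimizer_surgery_far hM4 hk1 hk hdiv hZblk hWW' hmin hin hout⟩

end

end Summit.QuantumFields.YangMills.BalabanUVNodes.N12FarDatumSurgeryB

end
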